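import Literature.MathematicalPhysics.QuantumLattice.TorusShellCountUniform
import HarnessLib

/-!
# Dyadic shell counting on the discrete torus: `Σ_m 4^{-m} #shell_m ≤ (40/3) θ² L² + (8/3) L`

Topic `MathematicalPhysics/QuantumLattice`; companion of `TorusShellCountUniform.lean`
(`card_torusShell_le_sqrt`: `#{k : |ε_L(k) - μ| ≤ η} ≤ √η·L² + 2L`, uniform in the level `μ`).
Here the geometrically weighted count over DYADIC shells around a level that the Hölder-type
estimate `Σ_k |ε_L(k) - μ|^{-1/3} = O(L²)` needs in discrete form:

* `sum_geomWeight_card_shell_le`: for a scale `θ ∈ (0, 1]`, every level `μ` and every number of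
  shells `M`,
  `Σ_{m<M} 4^{-m} · #{k ∈ (ℤ/Lℤ)² : 64^m θ⁶ ≤ |ε_L(k) - μ| < 64^{m+1} θ⁶} ≤ (40/3)·θ²·L² + (8/3)·L`.
  Proof: with `2^q ≤ 1/θ < 2^{q+1}`, the shells `m < q` are counted by the uniform bound
  (`≤ 8^{m+1} θ³ L² + 2L`, and `Σ_{m<q} 4^{-m} 8^{m+1} θ³ = 8θ³(2^q - 1) ≤ 8θ²`,
  `Σ_{m<q} 4^{-m}·2L ≤ (8/3)L`), the shells `m ≥ q` trivially (`≤ L²`, and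
  `Σ_{m≥q} 4^{-m} ≤ (4/3)4^{-q} < (16/3)θ²`).

The weight `4^{-m} = (64^m)^{-1/3}` is `|ε - μ|^{-1/3}` at the scale of the shell, so the lemma is
the statement `Σ_{|ε_k - μ| > θ⁶} |ε_k - μ|^{-1/3} ≲ θ^{-2}·(θ² L² + L)·θ⁶^{-1/3}` with dyadic
constants; it is consumed by the quadratic pairing-cost rate (`FreeFermiGasPairingCostSharp.lean`,
`sum_quarticMean_le_sharp`). The crude `√η` modulus of the uniform count is exactly what makes the
geometric series in `m` converge (any modulus `η^α`, `α > 1/3`, would do).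

Sources: elementary; S. Friedli, Y. Velenik (2017) §10.4 for the momentum grid. No named facts, no
definitions. Tree search: `lean search "geomWeight|card_shell|dyadic"` — nothing relevant; nearest
`card_torusShell_le_sqrt`, `card_torusShell_le` (`TorusShellCounting`).
-/

noncomputable section

namespace Literature.MathematicalPhysics.QuantumLattice

open Real Finset Literature.Probability.LatticeModels

section Dyadic

variable {L : ℕ} [NeZero L]

/-- **Geometrically weighted shell count.** For `θ ∈ (0,1]`, every level `μ` and every `M`:
`Σ_{m<M} 4^{-m} · #{k : 64^m θ⁶ ≤ |ε_L(k) - μ| < 64^{m+1} θ⁶} ≤ (40/3)·θ²·L² + (8/3)·L`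
(the uniform shell count `#{|ε - μ| ≤ η} ≤ √η L² + 2L` on the shells with `8^{m+1} θ³ ≤ 1`, i.e.
below the scale `2^q ≤ 1/θ < 2^{q+1}`, and the trivial count `L²` above it; two geometric sums).
[folklore] -/
theorem sum_geomWeight_card_shell_le {θ : ℝ} (hθ : 0 < θ) (hθ1 : θ ≤ 1) (μ : ℝ) (M : ℕ) :
    ∑ m ∈ Finset.range M, (1 / 4 : ℝ) ^ m *
        ((Finset.univ.filter fun k : TorusSite 2 L =>
            (64 : ℝ) ^ m * θ ^ 6 ≤ |torusBand L k - μ| ∧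
              |torusBand L k - μ| < (64 : ℝ) ^ (m + 1) * θ ^ 6).card : ℝ) ≤
      40 / 3 * θ ^ 2 * (L : ℝ) ^ 2 + 8 / 3 * L := by
  -- the dyadic scale of `1/θ`
  obtain ⟨q, hq1, hq2⟩ := exists_nat_pow_near (x := 1 / θ) (y := (2 : ℝ))
    (by rw [le_div_iff₀ hθ]; linarith) (by norm_num)
  have h2q : (2 : ℝ) ^ q * θ ≤ 1 := by rwa [le_div_iff₀ hθ] at hq1
  have h2q' : 1 < (2 : ℝ) ^ (q + 1) * θ := by rwa [div_lt_iff₀ hθ] at hq2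
  set A : ℕ → Finset (TorusSite 2 L) := fun m => Finset.univ.filter fun k : TorusSite 2 L =>
      (64 : ℝ) ^ m * θ ^ 6 ≤ |torusBand L k - μ| ∧
        |torusBand L k - μ| < (64 : ℝ) ^ (m + 1) * θ ^ 6 with hA
  have hL0 : (0 : ℝ) ≤ L := Nat.cast_nonneg _
  -- shell count on each dyadic shell, and the trivial count
  have hA_shell : ∀ m, ((A m).card : ℝ) ≤ 8 ^ (m + 1) * θ ^ 3 * (L : ℝ) ^ 2 + 2 * L := by
    intro m
    have hsub : A m ⊆ Finset.univ.filter
        (fun k : TorusSite 2 L => |torusBand L k - μ| ≤ (64 : ℝ) ^ (m + 1) * θ ^ 6) := by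
      intro k hk
      simp only [hA, Finset.mem_filter] at hk ⊢
      exact ⟨hk.1, hk.2.2.le⟩
    have h1 : ((A m).card : ℝ) ≤ ((Finset.univ.filter
        (fun k : TorusSite 2 L => |torusBand L k - μ| ≤ (64 : ℝ) ^ (m + 1) * θ ^ 6)).card : ℝ) := by
      exact_mod_cast Finset.card_le_card hsub
    have h2 := card_torusShell_le_sqrt (L := L) μ ((64 : ℝ) ^ (m + 1) * θ ^ 6)
    have hsqrt : Real.sqrt ((64 : ℝ) ^ (m + 1) * θ ^ 6) = 8 ^ (m + 1) * θ ^ 3 := by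
      rw [show (64 : ℝ) ^ (m + 1) * θ ^ 6 = (8 ^ (m + 1) * θ ^ 3) ^ 2 by
        rw [mul_pow, ← pow_mul, ← pow_mul, pow_mul' (8 : ℝ) (m + 1) 2]; norm_num]
      exact Real.sqrt_sq (by positivity)
    rw [hsqrt] at h2
    exact h1.trans h2
  have hA_univ : ∀ m, ((A m).card : ℝ) ≤ (L : ℝ) ^ 2 := by
    intro m
    have := Finset.card_le_univ (A m)
    rw [card_torusSite] at this
    exact_mod_cast this
  rw [← Finset.sum_filter_add_sum_filter_not (Finset.range M) (fun m => m < q)]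
  -- low shells: the uniform shell count and two geometric sums
  have hlow : ∑ m ∈ (Finset.range M).filter (fun m => m < q), (1 / 4 : ℝ) ^ m * ((A m).card : ℝ) ≤
      8 * θ ^ 2 * (L : ℝ) ^ 2 + 8 / 3 * L := by
    calc ∑ m ∈ (Finset.range M).filter (fun m => m < q), (1 / 4 : ℝ) ^ m * ((A m).card : ℝ)
        ≤ ∑ m ∈ Finset.range q, (1 / 4 : ℝ) ^ m * ((A m).card : ℝ) := by
          apply Finset.sum_le_sum_of_subset_of_nonneg
          · intro m hm
            simp only [Finset.mem_filter, Finset.mem_range] at hm ⊢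
            exact hm.2
          · intro m _ _
            positivity
      _ ≤ ∑ m ∈ Finset.range q, (8 * θ ^ 3 * (L : ℝ) ^ 2 * (2 : ℝ) ^ m + 2 * L * (1 / 4 : ℝ) ^ m) := by
          apply Finset.sum_le_sum
          intro m _
          have h4 : (0 : ℝ) ≤ (1 / 4 : ℝ) ^ m := by positivity
          have h := mul_le_mul_of_nonneg_left (hA_shell m) h4
          have hid : (1 / 4 : ℝ) ^ m * (8 : ℝ) ^ (m + 1) = 8 * 2 ^ m := by
            rw [pow_succ, ← mul_assoc, ← mul_pow]; norm_num; ring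
          calc (1 / 4 : ℝ) ^ m * ((A m).card : ℝ)
              ≤ (1 / 4 : ℝ) ^ m * (8 ^ (m + 1) * θ ^ 3 * (L : ℝ) ^ 2 + 2 * L) := h
            _ = (1 / 4 : ℝ) ^ m * (8 : ℝ) ^ (m + 1) * (θ ^ 3 * (L : ℝ) ^ 2) +
                  2 * L * (1 / 4 : ℝ) ^ m := by ring
            _ = _ := by rw [hid]; ring
      _ = 8 * θ ^ 3 * (L : ℝ) ^ 2 * ∑ m ∈ Finset.range q, (2 : ℝ) ^ m +
            2 * L * ∑ m ∈ Finset.range q, (1 / 4 : ℝ) ^ m := by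
          rw [Finset.sum_add_distrib, ← Finset.mul_sum, ← Finset.mul_sum]
      _ ≤ 8 * θ ^ 3 * (L : ℝ) ^ 2 * (2 : ℝ) ^ q + 2 * L * (4 / 3) := by
          have hg2 : ∑ m ∈ Finset.range q, (2 : ℝ) ^ m ≤ 2 ^ q := by
            rw [geom_sum_eq (by norm_num) q]
            norm_num
          have hg4 : ∑ m ∈ Finset.range q, (1 / 4 : ℝ) ^ m ≤ 4 / 3 := by
            have := geom_sum_Ico_le_of_lt_one (x := (1 / 4 : ℝ)) (m := 0) (n := q)
              (by norm_num) (by norm_num)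
            rw [Finset.range_eq_Ico]
            refine this.trans ?_
            norm_num
          have ha : 0 ≤ 8 * θ ^ 3 * (L : ℝ) ^ 2 := by positivity
          have hb : 0 ≤ 2 * (L : ℝ) := by positivity
          exact add_le_add (mul_le_mul_of_nonneg_left hg2 ha) (mul_le_mul_of_nonneg_left hg4 hb)
      _ ≤ 8 * θ ^ 2 * (L : ℝ) ^ 2 + 8 / 3 * L := by
          have hL2 : (0 : ℝ) ≤ θ ^ 2 * (L : ℝ) ^ 2 := by positivity
          have : θ ^ 3 * (2 : ℝ) ^ q ≤ θ ^ 2 := by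
            calc θ ^ 3 * (2 : ℝ) ^ q = θ ^ 2 * ((2 : ℝ) ^ q * θ) := by ring
              _ ≤ θ ^ 2 * 1 := mul_le_mul_of_nonneg_left h2q (by positivity)
              _ = θ ^ 2 := mul_one _
          nlinarith
  -- high shells: the trivial count and one geometric tail
  have hhigh : ∑ m ∈ (Finset.range M).filter (fun m => ¬ m < q), (1 / 4 : ℝ) ^ m * ((A m).card : ℝ) ≤
      16 / 3 * θ ^ 2 * (L : ℝ) ^ 2 := by
    calc ∑ m ∈ (Finset.range M).filter (fun m => ¬ m < q), (1 / 4 : ℝ) ^ m * ((A m).card : ℝ)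
        ≤ ∑ m ∈ (Finset.range M).filter (fun m => ¬ m < q), (1 / 4 : ℝ) ^ m * (L : ℝ) ^ 2 :=
          Finset.sum_le_sum fun m _ => mul_le_mul_of_nonneg_left (hA_univ m) (by positivity)
      _ ≤ ∑ m ∈ Finset.Ico q (max q M), (1 / 4 : ℝ) ^ m * (L : ℝ) ^ 2 := by
          apply Finset.sum_le_sum_of_subset_of_nonneg
          · intro m hm
            simp only [Finset.mem_filter, Finset.mem_range, not_lt] at hm
            simp only [Finset.mem_Ico]
            exact ⟨hm.2, lt_max_of_lt_right hm.1⟩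
          · intro m _ _
            positivity
      _ = (∑ m ∈ Finset.Ico q (max q M), (1 / 4 : ℝ) ^ m) * (L : ℝ) ^ 2 := by
          rw [Finset.sum_mul]
      _ ≤ (1 / 4 : ℝ) ^ q / (1 - 1 / 4) * (L : ℝ) ^ 2 :=
          mul_le_mul_of_nonneg_right (geom_sum_Ico_le_of_lt_one (by norm_num) (by norm_num))
            (by positivity)
      _ ≤ 16 / 3 * θ ^ 2 * (L : ℝ) ^ 2 := by
          have hL2 : (0 : ℝ) ≤ (L : ℝ) ^ 2 := by positivity
          -- `(1/4)^q < 4 θ²` from `1 < 2^(q+1) θ`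
          have h44 : (1 / 4 : ℝ) ^ q * (4 : ℝ) ^ q = 1 := by rw [← mul_pow]; norm_num
          have h4q : (4 : ℝ) ^ q = ((2 : ℝ) ^ q) ^ 2 := by
            rw [← pow_mul, show (4 : ℝ) = 2 ^ 2 by norm_num, ← pow_mul, mul_comm]
          have hsq : 1 < 4 * (4 : ℝ) ^ q * θ ^ 2 := by
            rw [pow_succ] at h2q'
            have h0 : 0 ≤ (2 : ℝ) ^ q * 2 * θ := by positivity
            nlinarith
          have hpos : (0 : ℝ) < (1 / 4 : ℝ) ^ q := by positivity
          have hlt : (1 / 4 : ℝ) ^ q ≤ 4 * θ ^ 2 := by nlinarith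
          have : (1 / 4 : ℝ) ^ q / (1 - 1 / 4) ≤ 16 / 3 * θ ^ 2 := by
            rw [div_le_iff₀ (by norm_num)]
            nlinarith
          nlinarith
  linarith

end Dyadic

end Literature.MathematicalPhysics.QuantumLattice
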